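import Mathlib
import HarnessLib
import Summits.KontsevichZagierPeriods.KontsevichZagierPeriods.Theses.LinRedNormalForm
import Summits.KontsevichZagierPeriods.KontsevichZagierPeriods.Theorems.LinRedNormalFormDihedralNormalFormStubTorusDescentAux1
import Summits.KontsevichZagierPeriods.KontsevichZagierPeriods.Theorems.FurushoPentagonHoffmanRelationInKZCubicalTransportAux
import Literature.NumberTheory.Transcendental.KZProductIdeal

/-!
# `DihedralNormalForm`, line `torus-descent-sum-shadow`, stub `stub_simplexProductSplit` — tools (Aux 1)

Support file for the stub `stub_simplexProductSplit` of the crux `DihedralNormalForm`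
(stmt-KontsevichZagierPeriods-3912, route `LinRedNormalForm`, skeleton v6): a convergent simplicial
Laurent monomial `[Δ_k, q·∏ tᵢ^{βᵢ}(1-tᵢ)^{γᵢ}∏_{i<j}(tᵢ-tⱼ)^{αᵢⱼ}]` whose forms do not cross the
seam `p` splits as a product of two such representations of dimensions `p` and `k - p`.  This file
collects the tools that do not involve the exponent bookkeeping (no new definitions: the chart and
its row supports enter through characterising hypotheses `hS₁`/`hS₂`, `hC₁`/`hC₂`, `hw₁`/`hw₂`):

* the simplicial Laurent monomial `q·∏ tᵢ^{βᵢ}(1-tᵢ)^{γᵢ}∏_{i<j}(tᵢ-tⱼ)^{αᵢⱼ}` is semialgebraic on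
  every semialgebraic set (`isSemialgebraicFunOn_smono`), vanishes nowhere on the open ordered
  simplex `KZ.openOrderedSimplex n = {1 > t₀ > ⋯ > t_{n-1} > 0}` for `q ≠ 0` (`smono_ne_zero`), and
  defines a representation there as soon as it converges absolutely (`exists_smonoRep`); the
  simplex has positive measure (`volume_openOrderedSimplex_ne_zero`);
* **Tonelli read backwards** (`integrableOn_factors`): if `f ⊗ g` is absolutely integrable on
  `A × B ⊆ ℝⁿ⁺ᵐ` (coordinates `Fin.castAdd` / `Fin.natAdd`, as in `KZ.IntegralRep.prodDomain`),
  the factors vanish nowhere and `A`, `B` have positive measure, then `f ∈ L¹(A)` and `g ∈ L¹(B)`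
  (`MeasureTheory.Integrable.prod_left_ae/right_ae` through `KZ.appendMeasurableEquiv`);
* **the dilation chart read backwards**, `C : (x ; u) ↦ (x ; x_p · u)` on `ℝ^{(p+1)+t}`
  (`hC₁`/`hC₂`): it is the MONOMIAL chart of the row supports `S i = {i}` (first block) /
  `{p, i}` (second block) (`hS₁`/`hS₂`; lower-triangular through the diagonal, Jacobian `x_p ^ t`, `jac_eq`) in the sense
  of `FurushoPentagon.HoffmanRelationInKZ.monomialChart_transport`, and maps the product
  `Δ_{p+1} × Δ_t` bijectively onto `Δ_{(p+1)+t}` (`glue_mem`, `image_chart`, `injOn_chart`), whence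
  ONE rule-2 move between `Δ_{(p+1)+t}` and the product domain (`chart_transport`).

References: M. Kontsevich, D. Zagier, *Periods* (2001), §1.2 rule (2), §4.1 (Fubini);
F. Brown, *Multiple zeta values and periods of moduli spaces* `𝔐_{0,n}`, Ann. Sci. ÉNS 42 (2009),
§2 (simplicial and cubical coordinates), §7 (product maps).
-/

noncomputable section

open MeasureTheory Set

namespace Summit.KontsevichZagierPeriods.DihedralNormalForm.TorusDescent

open Literature.NumberTheory.Transcendental
open Literature.ModelTheory.ExponentialFields (IsSemialgebraic)
open Summit.KontsevichZagierPeriods.FurushoPentagon.HoffmanRelationInKZ (monomialChart_transport)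

namespace SimplexProductSplit

/-! ## Simplicial Laurent monomials -/

/-- A simplicial Laurent monomial is `ℚ`-semialgebraic on every `ℚ`-semialgebraic set (rational
function; Mathlib's junk value `0⁻¹ = 0` included). [cite: BochnakCosteRoy1998, Prop. 2.2.6] -/
theorem isSemialgebraicFunOn_smono {n : ℕ} {W : Set (Fin n → ℝ)} (hW : IsSemialgebraic ℚ W)
    (q : ℚ) (β γ : Fin n → ℤ) (α : Fin n → Fin n → ℤ) :
    IsSemialgebraicFunOn ℚ W (fun x : Fin n → ℝ => (q : ℝ) * ((∏ i, x i ^ β i) *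
      (∏ i, (1 - x i) ^ γ i) * ∏ i, ∏ j, if i < j then (x i - x j) ^ α i j else 1)) := by
  have h1 : IsSemialgebraicFunOn ℚ W fun _ : Fin n → ℝ => (1 : ℝ) := by
    simpa using isSemialgebraicFunOn_const_ratCast hW 1
  refine (isSemialgebraicFunOn_const_ratCast hW q).fun_mul
    (IsSemialgebraicFunOn.fun_mul (IsSemialgebraicFunOn.fun_mul ?_ ?_) ?_)
  · exact IsSemialgebraicFunOn.fun_finsetProd _ hW fun i _ =>
      fun_zpow (isSemialgebraicFunOn_apply hW i) _
  · exact IsSemialgebraicFunOn.fun_finsetProd _ hW fun i _ =>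
      fun_zpow (h1.fun_sub (isSemialgebraicFunOn_apply hW i)) _
  · refine IsSemialgebraicFunOn.fun_finsetProd _ hW fun i _ =>
      IsSemialgebraicFunOn.fun_finsetProd _ hW fun j _ => ?_
    by_cases hij : i < j
    · simp only [if_pos hij]
      exact fun_zpow ((isSemialgebraicFunOn_apply hW i).fun_sub (isSemialgebraicFunOn_apply hW j)) _
    · simp only [if_neg hij]
      exact h1

/-- On the open ordered simplex a monomial with non-zero coefficient does not vanish (all its
bases `tᵢ`, `1 - tᵢ`, `tᵢ - tⱼ` (`i < j`) are positive). -/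
theorem smono_ne_zero {n : ℕ} {q : ℚ} (hq : q ≠ 0) (β γ : Fin n → ℤ) (α : Fin n → Fin n → ℤ)
    {x : Fin n → ℝ} (hx : x ∈ KZ.openOrderedSimplex n) :
    (q : ℝ) * ((∏ i, x i ^ β i) * (∏ i, (1 - x i) ^ γ i) *
      ∏ i, ∏ j, if i < j then (x i - x j) ^ α i j else 1) ≠ 0 := by
  obtain ⟨h0, h1, hanti⟩ := hx
  refine mul_ne_zero (by exact_mod_cast hq) (mul_ne_zero (mul_ne_zero ?_ ?_) ?_)
  · exact Finset.prod_ne_zero_iff.2 fun i _ => zpow_ne_zero _ (h0 i).ne'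
  · exact Finset.prod_ne_zero_iff.2 fun i _ => zpow_ne_zero _ (sub_pos.2 (h1 i)).ne'
  · refine Finset.prod_ne_zero_iff.2 fun i _ => Finset.prod_ne_zero_iff.2 fun j _ => ?_
    split_ifs with hij
    · exact zpow_ne_zero _ (sub_pos.2 (hanti hij)).ne'
    · exact one_ne_zero

/-- **The simplicial monomial representation** `[Δ_n, q·∏ tᵢ^{βᵢ}(1-tᵢ)^{γᵢ}∏_{i<j}(tᵢ-tⱼ)^{αᵢⱼ}]`
exists as soon as the monomial is absolutely integrable on the open ordered simplex. -/
theorem exists_smonoRep (n : ℕ) (q : ℚ) (β γ : Fin n → ℤ) (α : Fin n → Fin n → ℤ)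
    (h : IntegrableOn (fun x : Fin n → ℝ => (q : ℝ) * ((∏ i, x i ^ β i) *
      (∏ i, (1 - x i) ^ γ i) * ∏ i, ∏ j, if i < j then (x i - x j) ^ α i j else 1))
      (KZ.openOrderedSimplex n)) :
    ∃ s : KZ.IntegralRep n, s.domain = KZ.openOrderedSimplex n ∧
      s.integrand = fun x : Fin n → ℝ => (q : ℝ) * ((∏ i, x i ^ β i) *
        (∏ i, (1 - x i) ^ γ i) * ∏ i, ∏ j, if i < j then (x i - x j) ^ α i j else 1) :=
  ⟨⟨_, _, KZ.isSemialgebraic_openOrderedSimplex n,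
    isSemialgebraicFunOn_smono (KZ.isSemialgebraic_openOrderedSimplex n) q β γ α, h⟩, rfl, rfl⟩

/-- The open ordered simplex has positive Lebesgue measure (open and non-empty). -/
theorem volume_openOrderedSimplex_ne_zero (n : ℕ) : volume (KZ.openOrderedSimplex n) ≠ 0 := by
  refine ((KZ.isOpen_openOrderedSimplex n).measure_pos volume
    ⟨fun i => 1 / (((i : ℕ) : ℝ) + 2), fun i => ?_, fun i => ?_, fun i j hij => ?_⟩).ne'
  · positivity
  · rw [div_lt_one (by positivity)]
    linarith [(Nat.cast_nonneg (i : ℕ) : (0:ℝ) ≤ (i : ℕ))]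
  · apply one_div_lt_one_div_of_lt (by positivity)
    have : ((i : ℕ) : ℝ) < (j : ℕ) := by exact_mod_cast hij
    linarith

/-- **Tonelli, read backwards.**  If `f ⊗ g` is absolutely integrable on `A × B` (in the
coordinates `Fin.castAdd` / `Fin.natAdd` of `ℝⁿ⁺ᵐ`), both factors vanish nowhere on their
domains and both domains have positive measure, then `f` is integrable on `A` and `g` on `B`. -/
theorem integrableOn_factors {n m : ℕ} {A : Set (Fin n → ℝ)} {B : Set (Fin m → ℝ)}
    (hA : MeasurableSet A) (hB : MeasurableSet B) (hA0 : volume A ≠ 0) (hB0 : volume B ≠ 0)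
    {f : (Fin n → ℝ) → ℝ} {g : (Fin m → ℝ) → ℝ} (hf : ∀ x ∈ A, f x ≠ 0) (hg : ∀ y ∈ B, g y ≠ 0)
    (h : IntegrableOn (fun z : Fin (n + m) → ℝ =>
        f (fun i => z (Fin.castAdd m i)) * g (fun j => z (Fin.natAdd n j)))
      {z | (fun i => z (Fin.castAdd m i)) ∈ A ∧ (fun j => z (Fin.natAdd n j)) ∈ B}) :
    IntegrableOn f A ∧ IntegrableOn g B := by
  set e := KZ.appendMeasurableEquiv n m
  have hpre : e ⁻¹' {z | (fun i => z (Fin.castAdd m i)) ∈ A ∧ (fun j => z (Fin.natAdd n j)) ∈ B}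
      = A ×ˢ B := by
    ext p
    simp [e]
  have hcomp : (fun z : Fin (n + m) → ℝ =>
      f (fun i => z (Fin.castAdd m i)) * g (fun j => z (Fin.natAdd n j))) ∘ e
      = fun p => f p.1 * g p.2 := by
    funext p
    simp [e]
  have H := (KZ.volume_preserving_appendMeasurableEquiv.integrableOn_comp_preimage
    e.measurableEmbedding).mpr h
  rw [hpre, hcomp, IntegrableOn, Measure.volume_eq_prod, ← Measure.prod_restrict] at H
  haveI : (ae (volume.restrict A)).NeBot := ae_neBot.mpr (by rwa [Ne, Measure.restrict_eq_zero])
  haveI : (ae (volume.restrict B)).NeBot := ae_neBot.mpr (by rwa [Ne, Measure.restrict_eq_zero])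
  constructor
  · obtain ⟨y, hyB, hy⟩ := ((ae_restrict_mem hB).and H.prod_left_ae).exists
    have hgy : g y ≠ 0 := hg y hyB
    refine (hy.const_mul (g y)⁻¹).congr (ae_of_all _ fun x => ?_)
    show (g y)⁻¹ * (f x * g y) = f x
    field_simp
  · obtain ⟨x, hxA, hx⟩ := ((ae_restrict_mem hA).and H.prod_right_ae).exists
    have hfx : f x ≠ 0 := hf x hxA
    refine (hx.const_mul (f x)⁻¹).congr (ae_of_all _ fun y => ?_)
    show (f x)⁻¹ * (f x * g y) = g y
    rw [inv_mul_cancel_left₀ hfx]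

/-! ## The dilation chart `(x ; u) ↦ (x ; x_p · u)` on `ℝ^{(p+1)+t}` -/

section Chart

variable {p t : ℕ}

/-- The pivot (last index of the first block) is not in the second block. -/
theorem castAdd_last_ne_natAdd (m : Fin t) :
    (Fin.castAdd t (Fin.last p) : Fin (p + 1 + t)) ≠ Fin.natAdd (p + 1) m := by
  intro h
  have := congrArg Fin.val h
  rw [Fin.val_castAdd, Fin.val_natAdd, Fin.val_last] at this
  omega

/-- First-block indices precede second-block indices. -/
theorem castAdd_lt_natAdd (a : Fin (p + 1)) (m : Fin t) :
    (Fin.castAdd t a : Fin (p + 1 + t)) < Fin.natAdd (p + 1) m := by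
  rw [Fin.lt_def, Fin.val_castAdd, Fin.val_natAdd]
  have := a.2
  omega

/-! ### Row supports: `{i}` on the first block, `{pivot, i}` on the second -/

section Rows

variable {S : Fin (p + 1 + t) → Finset (Fin (p + 1 + t))}
  (hS₁ : ∀ a : Fin (p + 1), S (Fin.castAdd t a) = {Fin.castAdd t a})

include hS₁ in
/-- On the first block the monomial chart of `S` is the identity. -/
theorem prod_rows_castAdd (z : Fin (p + 1 + t) → ℝ) (a : Fin (p + 1)) :
    ∏ j ∈ S (Fin.castAdd t a), z j = z (Fin.castAdd t a) := by
  rw [hS₁, Finset.prod_singleton]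

variable (hS₂ : ∀ m : Fin t,
  S (Fin.natAdd (p + 1) m) = {Fin.castAdd t (Fin.last p), Fin.natAdd (p + 1) m})

include hS₂ in
/-- On the second block the monomial chart of `S` multiplies by the pivot. -/
theorem prod_rows_natAdd (z : Fin (p + 1 + t) → ℝ) (m : Fin t) :
    ∏ j ∈ S (Fin.natAdd (p + 1) m), z j =
      z (Fin.castAdd t (Fin.last p)) * z (Fin.natAdd (p + 1) m) := by
  rw [hS₂, Finset.prod_pair (castAdd_last_ne_natAdd m)]

include hS₁ hS₂

/-- **The Jacobian of the chart is `x_p ^ t`** (product of the off-diagonal row entries). -/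
theorem jac_eq (z : Fin (p + 1 + t) → ℝ) :
    ∏ i, ∏ k ∈ (S i).erase i, z k = z (Fin.castAdd t (Fin.last p)) ^ t := by
  rw [Fin.prod_univ_add]
  have h1 : ∏ a : Fin (p + 1), ∏ k ∈ (S (Fin.castAdd t a)).erase (Fin.castAdd t a), z k = 1 :=
    Finset.prod_eq_one fun a _ => by rw [hS₁, Finset.erase_singleton, Finset.prod_empty]
  have h2 : ∀ m : Fin t, ∏ k ∈ (S (Fin.natAdd (p + 1) m)).erase (Fin.natAdd (p + 1) m), z k =
      z (Fin.castAdd t (Fin.last p)) := by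
    intro m
    rw [hS₂, Finset.pair_comm, Finset.erase_insert, Finset.prod_singleton]
    rw [Finset.mem_singleton]
    exact (castAdd_last_ne_natAdd m).symm
  rw [h1, one_mul, Finset.prod_congr rfl fun m _ => h2 m, Finset.prod_const, Finset.card_univ,
    Fintype.card_fin]

end Rows

/-! ### The chart on ordered configurations -/

/-- Gluing two ordered configurations `x ∈ Δ_{p+1}`, `u ∈ Δ_t` as `(x ; x_p · u)` gives an ordered
configuration of `Δ_{(p+1)+t}`. -/
theorem glue_mem {x : Fin (p + 1) → ℝ} {u : Fin t → ℝ} {w : Fin (p + 1 + t) → ℝ}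
    (hw₁ : ∀ a, w (Fin.castAdd t a) = x a) (hw₂ : ∀ m, w (Fin.natAdd (p + 1) m) = x (Fin.last p) * u m)
    (hx : x ∈ KZ.openOrderedSimplex (p + 1)) (hu : u ∈ KZ.openOrderedSimplex t) :
    w ∈ KZ.openOrderedSimplex (p + 1 + t) := by
  obtain ⟨hx0, hx1, hxa⟩ := hx
  obtain ⟨hu0, hu1, hua⟩ := hu
  have hl0 : 0 < x (Fin.last p) := hx0 _
  have hle : ∀ a, x (Fin.last p) ≤ x a := fun a => hxa.antitone (Fin.le_last a)
  have hlt : ∀ m, x (Fin.last p) * u m < x (Fin.last p) := fun m => by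
    calc x (Fin.last p) * u m < x (Fin.last p) * 1 := mul_lt_mul_of_pos_left (hu1 m) hl0
      _ = x (Fin.last p) := mul_one _
  refine ⟨fun i => ?_, fun i => ?_, fun i j hij => ?_⟩
  · induction i using Fin.addCases with
    | left a => rw [hw₁]; exact hx0 a
    | right m => rw [hw₂]; exact mul_pos hl0 (hu0 m)
  · induction i using Fin.addCases with
    | left a => rw [hw₁]; exact hx1 a
    | right m => rw [hw₂]; exact (hlt m).trans (hx1 _)
  · induction i using Fin.addCases with
    | left a =>
      induction j using Fin.addCases with
      | left b =>
        rw [hw₁, hw₁]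
        exact hxa ((Fin.strictMono_castAdd t).lt_iff_lt.mp hij)
      | right m =>
        rw [hw₁, hw₂]
        exact (hlt m).trans_le (hle a)
    | right m =>
      induction j using Fin.addCases with
      | left b => exact absurd (hij.trans (castAdd_lt_natAdd b m)) (lt_irrefl _)
      | right m' =>
        rw [hw₂, hw₂]
        exact mul_lt_mul_of_pos_left (hua ((Fin.natAdd_lt_natAdd_iff (p + 1)).mp hij)) hl0

/-- The product domain `Δ_{p+1} × Δ_t ⊆ ℝ^{(p+1)+t}` is `ℚ`-semialgebraic (two coordinate
cylinders). -/
theorem isSemialgebraic_pdom : IsSemialgebraic ℚ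
    {z : Fin (p + 1 + t) → ℝ | (fun a => z (Fin.castAdd t a)) ∈ KZ.openOrderedSimplex (p + 1) ∧
      (fun m => z (Fin.natAdd (p + 1) m)) ∈ KZ.openOrderedSimplex t} :=
  ((KZ.isSemialgebraic_openOrderedSimplex (p + 1)).preimage_comp (Fin.castAdd t)).inter
    ((KZ.isSemialgebraic_openOrderedSimplex t).preimage_comp (Fin.natAdd (p + 1)))

variable {C : (Fin (p + 1 + t) → ℝ) → Fin (p + 1 + t) → ℝ}
  (hC₁ : ∀ z a, C z (Fin.castAdd t a) = z (Fin.castAdd t a))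
  (hC₂ : ∀ z m, C z (Fin.natAdd (p + 1) m) = z (Fin.castAdd t (Fin.last p)) * z (Fin.natAdd (p + 1) m))

include hC₁ hC₂

/-- The chart maps `Δ_{p+1} × Δ_t` into `Δ_{(p+1)+t}`. -/
theorem chart_mem {z : Fin (p + 1 + t) → ℝ}
    (hz : z ∈ {z : Fin (p + 1 + t) → ℝ | (fun a => z (Fin.castAdd t a)) ∈ KZ.openOrderedSimplex (p + 1) ∧
      (fun m => z (Fin.natAdd (p + 1) m)) ∈ KZ.openOrderedSimplex t}) :
    C z ∈ KZ.openOrderedSimplex (p + 1 + t) :=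
  glue_mem (x := fun a => z (Fin.castAdd t a)) (hC₁ z) (hC₂ z) hz.1 hz.2

/-- Every ordered configuration is in the image of the chart: `w = C (w|₁ ; w|₂ / w_p)`. -/
theorem exists_chart_eq {w : Fin (p + 1 + t) → ℝ} (hw : w ∈ KZ.openOrderedSimplex (p + 1 + t)) :
    ∃ z ∈ {z : Fin (p + 1 + t) → ℝ | (fun a => z (Fin.castAdd t a)) ∈ KZ.openOrderedSimplex (p + 1) ∧
      (fun m => z (Fin.natAdd (p + 1) m)) ∈ KZ.openOrderedSimplex t}, C z = w := by
  obtain ⟨hw0, hw1, hwa⟩ := hw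
  have hpiv : 0 < w (Fin.castAdd t (Fin.last p)) := hw0 _
  refine ⟨Fin.append (fun a => w (Fin.castAdd t a))
    (fun m => w (Fin.natAdd (p + 1) m) / w (Fin.castAdd t (Fin.last p))), ⟨?_, ?_⟩, ?_⟩
  · simp only [Fin.append_left]
    exact ⟨fun a => hw0 _, fun a => hw1 _,
      fun a b hab => hwa ((Fin.strictMono_castAdd t).lt_iff_lt.mpr hab)⟩
  · simp only [Fin.append_right]
    refine ⟨fun m => div_pos (hw0 _) hpiv, fun m => ?_, fun m m' hmm' => ?_⟩
    · rw [div_lt_one hpiv]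
      exact hwa (castAdd_lt_natAdd _ m)
    · exact div_lt_div_of_pos_right (hwa ((Fin.natAdd_lt_natAdd_iff (p + 1)).mpr hmm')) hpiv
  · ext i
    induction i using Fin.addCases with
    | left a => rw [hC₁, Fin.append_left]
    | right m =>
      rw [hC₂, Fin.append_right, Fin.append_left]
      exact mul_div_cancel₀ _ hpiv.ne'

/-- **The chart maps `Δ_{p+1} × Δ_t` onto `Δ_{(p+1)+t}`.** -/
theorem image_chart :
    C '' {z : Fin (p + 1 + t) → ℝ | (fun a => z (Fin.castAdd t a)) ∈ KZ.openOrderedSimplex (p + 1) ∧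
      (fun m => z (Fin.natAdd (p + 1) m)) ∈ KZ.openOrderedSimplex t} =
      KZ.openOrderedSimplex (p + 1 + t) := by
  refine Subset.antisymm ?_ fun w hw => ?_
  · rintro _ ⟨z, hz, rfl⟩
    exact chart_mem hC₁ hC₂ hz
  · obtain ⟨z, hz, rfl⟩ := exists_chart_eq hC₁ hC₂ hw
    exact mem_image_of_mem _ hz

/-- **The chart is injective on `Δ_{p+1} × Δ_t`** (the pivot is positive there). -/
theorem injOn_chart :
    InjOn C {z : Fin (p + 1 + t) → ℝ | (fun a => z (Fin.castAdd t a)) ∈ KZ.openOrderedSimplex (p + 1) ∧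
      (fun m => z (Fin.natAdd (p + 1) m)) ∈ KZ.openOrderedSimplex t} := by
  intro z hz z' hz' h
  have hL : ∀ a, z (Fin.castAdd t a) = z' (Fin.castAdd t a) := fun a => by
    rw [← hC₁ z, ← hC₁ z', h]
  have hpiv0 : z' (Fin.castAdd t (Fin.last p)) ≠ 0 := (hz'.1.1 (Fin.last p)).ne'
  ext i
  induction i using Fin.addCases with
  | left a => exact hL a
  | right m =>
    have := congrFun h (Fin.natAdd (p + 1) m)
    rw [hC₂, hC₂, hL] at this
    exact mul_left_cancel₀ hpiv0 this

omit hC₁ hC₂ in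
/-- **Transport along the dilation chart** (ONE Kontsevich–Zagier change of variables):
`FurushoPentagon.HoffmanRelationInKZ.monomialChart_transport` specialised to the monomial chart
`C` of the rows `S` (`hS₁`/`hS₂`: lower-triangular rows through the diagonal, Jacobian `x_p ^ t`,
injective on `Δ_{p+1} × Δ_t` with image `Δ_{(p+1)+t}`).  (i) If some representation carries `h`
on `Δ_{(p+1)+t}`, then `(Δ_{p+1} × Δ_t, g)` is a representation for every `g` that equals
`(h ∘ C) · x_p^t` there; (ii) any two such representations are KZ-equivalent.
[cite: KontsevichZagier2001, §1.2 rule (2)] -/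
theorem chart_transport {S : Fin (p + 1 + t) → Finset (Fin (p + 1 + t))}
    (hS₁ : ∀ a : Fin (p + 1), S (Fin.castAdd t a) = {Fin.castAdd t a})
    (hS₂ : ∀ m : Fin t,
      S (Fin.natAdd (p + 1) m) = {Fin.castAdd t (Fin.last p), Fin.natAdd (p + 1) m})
    (hC : ∀ z i, C z i = ∏ j ∈ S i, z j) (g h : (Fin (p + 1 + t) → ℝ) → ℝ)
    (hgh : ∀ z ∈ {z : Fin (p + 1 + t) → ℝ | (fun a => z (Fin.castAdd t a)) ∈
        KZ.openOrderedSimplex (p + 1) ∧ (fun m => z (Fin.natAdd (p + 1) m)) ∈ KZ.openOrderedSimplex t},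
      g z = h (C z) * z (Fin.castAdd t (Fin.last p)) ^ t) :
    (∀ r' : KZ.IntegralRep (p + 1 + t), r'.domain = KZ.openOrderedSimplex (p + 1 + t) →
        EqOn r'.integrand h r'.domain → ∃ r : KZ.IntegralRep (p + 1 + t),
          r.domain = {z : Fin (p + 1 + t) → ℝ | (fun a => z (Fin.castAdd t a)) ∈
            KZ.openOrderedSimplex (p + 1) ∧
            (fun m => z (Fin.natAdd (p + 1) m)) ∈ KZ.openOrderedSimplex t} ∧ r.integrand = g) ∧
    (∀ r r' : KZ.IntegralRep (p + 1 + t),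
        r.domain = {z : Fin (p + 1 + t) → ℝ | (fun a => z (Fin.castAdd t a)) ∈
          KZ.openOrderedSimplex (p + 1) ∧
          (fun m => z (Fin.natAdd (p + 1) m)) ∈ KZ.openOrderedSimplex t} →
        EqOn r.integrand g r.domain → r'.domain = KZ.openOrderedSimplex (p + 1 + t) →
        EqOn r'.integrand h r'.domain → KZ.Equivalent r r') := by
  have hC₁ : ∀ z a, C z (Fin.castAdd t a) = z (Fin.castAdd t a) := fun z a => by
    rw [hC, prod_rows_castAdd hS₁]
  have hC₂ : ∀ z m, C z (Fin.natAdd (p + 1) m) =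
      z (Fin.castAdd t (Fin.last p)) * z (Fin.natAdd (p + 1) m) := fun z m => by
    rw [hC, prod_rows_natAdd hS₂]
  have hle : ∀ i, ∀ j ∈ S i, j ≤ i := by
    intro i j hj
    induction i using Fin.addCases with
    | left a =>
      rw [hS₁, Finset.mem_singleton] at hj
      exact hj.le
    | right m =>
      rw [hS₂, Finset.mem_insert, Finset.mem_singleton] at hj
      rcases hj with rfl | rfl
      · exact (castAdd_lt_natAdd _ m).le
      · exact le_rfl
  have hmem : ∀ i, i ∈ S i := by
    intro i
    induction i using Fin.addCases with
    | left a => rw [hS₁]; exact Finset.mem_singleton_self _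
    | right m => rw [hS₂]; simp
  have key := monomialChart_transport S hle hmem isSemialgebraic_pdom C hC (injOn_chart hC₁ hC₂) g h
    fun z hz => by
      have hpos : 0 < z (Fin.castAdd t (Fin.last p)) := hz.1.1 (Fin.last p)
      rw [jac_eq hS₁ hS₂, abs_of_pos (pow_pos hpos t)]
      exact hgh z hz
  rw [image_chart hC₁ hC₂] at key
  exact ⟨key.1, fun r r' hd hg hd' hh => key.2 r r' hd (hd ▸ hg) hd' hh⟩

end Chart

end SimplexProductSplit

open SimplexProductSplit in
/-- **`stub_simplexProductSplitAux1`** (registered support stub of `stub_simplexProductSplit`): the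
dilation chart read backwards glues two ordered configurations `x ∈ Δ_{p+1}`, `u ∈ Δ_t` into the
ordered configuration `(x ; x_p · u) ∈ Δ_{(p+1)+t}` (`SimplexProductSplit.glue_mem`). -/
theorem stub_simplexProductSplitAux1 : ∀ (p t : ℕ) (x : Fin (p + 1) → ℝ) (u : Fin t → ℝ), x ∈ {v : Fin (p + 1) → ℝ | (∀ i, 0 < v i) ∧ (∀ i, v i < 1) ∧ StrictAnti v} → u ∈ {v : Fin t → ℝ | (∀ i, 0 < v i) ∧ (∀ i, v i < 1) ∧ StrictAnti v} → (Fin.append x (fun m => x (Fin.last p) * u m) : Fin (p + 1 + t) → ℝ) ∈ {v : Fin (p + 1 + t) → ℝ | (∀ i, 0 < v i) ∧ (∀ i, v i < 1) ∧ StrictAnti v} :=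
  fun _ _ x _ hx hu => glue_mem (fun a => Fin.append_left x _ a) (fun m => Fin.append_right x _ m) hx hu

end Summit.KontsevichZagierPeriods.DihedralNormalForm.TorusDescent

end
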